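import Mathlib
import HarnessLib
import Summits.HubbardSuperconductivity.HubbardSuperconductivity.Theorems.KLProgrammeKLRegimeTwoVolumeFarStep
import Literature.MathematicalPhysics.QuantumLattice.GrassmannDefectSplit
import Literature.MathematicalPhysics.QuantumLattice.GrassmannEffectiveActionGradedTruncationDB
import Literature.MathematicalPhysics.QuantumLattice.GrassmannGaussConvEntryGram

/-!
# Route `KLProgramme` — crux K3 ENGINE (stmt-HubbardSuperconductivity-20437), stub (e) proof-input «(e)-D-ROWS», F-D5b first brick: THE DEFECT-COVARIANCE STEP
# IN THE GRADED CURRENCY — the near bracket by the graded one-input door + the entry-cost first order, the far bracket by the Polchinski path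
# (seat hubbard-kl-k3c4-p1 g23; `--supports` 20437; DROWS-SCOPE-g22 §7.3 (S-near)/(S-far), DROWS-SCOPE-g23 §9.2/§9.4 F-D5b)

The GRADED twin of k3c5-p2's `…TwoVolumeDefectStep.sum_norm_kernel_twoVolumeDefect_le` (β′ chain).  For `C' = C + D_n + D_f` on one Grassmann algebra, an even
input `V` without constant part, `W := effAction C V`, `W₁ := effAction D_f W`:
`effAction C' V − effAction C V = [effAction D_n W₁ − W₁] + [effAction D_f W − W]` (`Lit/GrassmannDefectSplit`).  The FAR bracket is the same as there
(`…TwoVolumeFarStep.sum_norm_kernel_effAction_sub_self_le_of_far`: first moments over the distance `R`).  The NEAR bracket is bounded in the LAW-SHAPED currency a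
graded tower consumes: orders `≥ 2` by `Lit/GrassmannEffectiveActionGradedTruncationDB.sum_norm_kernel_effAction_sub_gaussConv_le_graded_of_gramBounded` at the small
covariance `D_n` (`κ_n`, `α_n`: telescoped product form on the leg constraint + geometric tail), first order by
`Lit/GrassmannGaussConvEntryGram.sum_wt_norm_kernel_gaussConv_sub_le_entry_of_gramBounded` (ONE contraction at the entry sup `s_n`, the rest Gram–binomial; tree weight
`1`) — instead of the flat near-identity step (whose remainder has no perturbative order, DROWS-SCOPE-g22 §7.1's objection applied to the near source):

* **`sum_norm_kernel_twoVolumeDefect_le_graded`** — in every degree `n+1`, at the pin `w`,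
  `Σ_{X : X_p = w} ‖kernel (effAction C' V) (n+1) X − kernel (effAction C V) (n+1) X‖ ≤ [FO_entry(s_n; N_n) + GRADED(κ_n, α_n; N_n) + tail] + FAR`.

In «(e)-D-ROWS» this is applied on the analysed fine labels `Γ_k(bL)` with `C := klCopiesCov C′_L`, `C' := C′_{bL}`, `V := klGlue (klLipInput L …)`
(`…TwoVolumeLipSourceSplit.lipSourceDefect_eq`), the pieces `D_n/D_f` and their sizes from `…TwoVolumeBlockDefect` (periodisation), and the output fed as `E/ND` to the
transfer door p550784; kit readings p696769 `src_le_law` (near, `σₑ := s_n`) and p699154 `farSrc_le_law` (far).  Sorry-free; no definition; nothing is asserted about the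
model; nothing asserts the (D) rows, stub (e), VL, K3 or superconductivity.  References: BGM 2006 (2.13)–(2.14), (2.77)–(2.90), §3 [cite: BenfattoGiulianiMastropietro2006];
Salmhofer 1998 §3.1 Prop. 1, §4.1.
-/

noncomputable section

namespace Summit.HubbardSuperconductivity.HubbardSuperconductivity.Theorems.TwoVolumeDefect

set_option linter.dupNamespace false -- summit = problem name (single-conjunct summit), D-0017

open Finset Literature.MathematicalPhysics.QuantumLattice GrassmannAlgebra Literature.Probability.LatticeModels
  Literature.Probability.LatticeModels.BattleFederbush
open scoped Nat InnerProductSpace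

variable {𝕜 : Type*} [RCLike 𝕜] {Γ : Type} [LinearOrder Γ] [Fintype Γ]

/-- **THE DEFECT-COVARIANCE STEP IN THE GRADED CURRENCY** (β′ chain: `GrassmannDefectSplit` ∘ [graded one-input door + entry-cost first order at `D_n`] ∘
`…TwoVolumeFarStep`).  Hypotheses as in `sum_norm_kernel_twoVolumeDefect_le` except the NEAR block: entry sup `s_n`, Gram constant `κ_n`, row/column sums `α_n` of
`D_n`; an EVEN-degree pinned profile `N_n` of `W₁ := effAction D_f (effAction C V)`; radius `ρ_n`, smallness `e·α_n·‖N_n‖_h/κ_n² < 1`, truncation order `N₀ ≥ 2`.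
[folklore; BGM 2006 (2.13)–(2.14), (2.77)–(2.90); Salmhofer 1998 §3.1/§4.1] -/
theorem sum_norm_kernel_twoVolumeDefect_le_graded {E : Type*} [NormedAddCommGroup E] [InnerProductSpace 𝕜 E]
    (C Dn Df : Matrix Γ Γ 𝕜) (V : GrassmannAlgebra 𝕜 Γ) (hVe : V ∈ evenPart 𝕜 Γ) (hV0 : constPart 𝕜 V = 0)
    (hZC : IsUnit (effPartitionFn 𝕜 C V))
    -- FAR defect `Df`: Gram form, support, sizes, distance
    (q : Γ → Bool) (hq : ∀ X Y, q X = q Y → Df X Y = 0) (f g : Γ → E) {κf : ℝ} (hκf : 0 < κf)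
    (hf : ∀ X, q X = true → ‖f X‖ ≤ κf) (hg : ∀ Y, q Y = false → ‖g Y‖ ≤ κf)
    (hG : ∀ X Y, q X = true → q Y = false → contr 𝕜 Df X Y = ⟪f X, g Y⟫_𝕜)
    {Zs : Set Γ} [DecidablePred (· ∈ Zs)] (hfar : ∀ X Y, ¬ (X ∈ Zs ∧ Y ∈ Zs) → Df X Y = 0)
    {sD : ℝ} (hsD0 : 0 ≤ sD) (hsD : ∀ X Y, ‖Df X Y‖ ≤ sD)
    {αf : ℝ} (hαf : 0 < αf) (hfrow : ∀ X, ∑ Y, ‖Df X Y‖ ≤ αf) (hfcol : ∀ Y, ∑ X, ‖Df X Y‖ ≤ αf)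
    (d : Γ → ℝ) (hd0 : ∀ X, 0 ≤ d X) {R : ℝ} (hRpos : 0 < R) (hdR : ∀ X, X ∈ Zs → R ≤ d X) (w : Γ)
    -- profile of `W := effAction C V` (even degrees) and the single-scale smallness at `Df`
    (Nf : ℕ → ℝ) (hNf0 : ∀ m', 0 ≤ Nf m')
    (hNf : ∀ m' (j : Fin (2 * m')) (x : Γ), ∑ Y ∈ univ.filter (fun Y : Fin (2 * m') → Γ => Y j = x), ‖kernel 𝕜 (effAction 𝕜 C V) (2 * m') Y‖ ≤ Nf m')
    {ρf : ℝ} (hρf : 0 < ρf) (hθf : Real.exp 1 * αf * normV Γ κf ρf Nf / κf ^ 2 < 1)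
    -- uniform-in-`s` kernel data of `𝒱_s := effAction (s•Df) W`
    (nV mV mL : ℕ → ℝ) (hnV : ∀ m, 0 ≤ nV m) (hmV : ∀ m, 0 ≤ mV m)
    (hVs0 : ∀ s ∈ Set.Icc (0 : ℝ) 1, ∀ (m : ℕ) (x : Γ),
      ∑ U ∈ univ.filter (fun U : Fin (m + 1) → Γ => U 0 = x), ‖kernel 𝕜 (effAction 𝕜 (s • Df) (effAction 𝕜 C V)) (m + 1) U‖ ≤ nV (m + 1))
    (hVsm : ∀ s ∈ Set.Icc (0 : ℝ) 1, ∀ (m : ℕ) (i : Fin m),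
      ∑ U ∈ univ.filter (fun U : Fin (m + 1) → Γ => U i.succ = w),
        d (U 0) * ‖kernel 𝕜 (effAction 𝕜 (s • Df) (effAction 𝕜 C V)) (m + 1) U‖ ≤ mV (m + 1))
    (n : ℕ) (p : Fin (n + 1))
    (hVsL : ∀ s ∈ Set.Icc (0 : ℝ) 1,
      ∑ Z ∈ univ.filter (fun Z : Fin (n + 1 + 1 + 1) → Γ => Z (Fin.castSucc (Fin.castSucc p)) = w),
        d (Z (Fin.last (n + 1 + 1))) * ‖kernel 𝕜 (effAction 𝕜 (s • Df) (effAction 𝕜 C V)) (n + 1 + 2) Z‖ ≤ mL (n + 3))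
    -- NEAR defect `Dn`: Gram bound, sizes, EVEN-degree profile of `W₁ := effAction Df W`, smallness, truncation order
    {κn : ℝ} (hκn : 0 < κn) (hGBn : IsGramBoundedR Dn κn)
    {αn : ℝ} (hαn : 0 < αn) (hnrow : ∀ X, ∑ Y, ‖Dn X Y‖ ≤ αn) (hncol : ∀ Y, ∑ X, ‖Dn X Y‖ ≤ αn)
    {sn : ℝ} (hsn : ∀ A B, ‖Dn A B‖ ≤ sn)
    (Nn : ℕ → ℝ) (hNn0 : ∀ m', 0 ≤ Nn m')
    (hNn : ∀ (m' : ℕ) (j : Fin (2 * m')) (x : Γ), ∑ Z ∈ univ.filter (fun Z : Fin (2 * m') → Γ => Z j = x),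
      ‖kernel 𝕜 (effAction 𝕜 Df (effAction 𝕜 C V)) (2 * m') Z‖ ≤ Nn m')
    {ρn : ℝ} (hρn : 0 < ρn) (hθn : Real.exp 1 * αn * normV Γ κn ρn Nn / κn ^ 2 < 1) {N₀ : ℕ} (hN₀ : 2 ≤ N₀) :
    ∑ X ∈ univ.filter (fun X : Fin (n + 1) → Γ => X p = w),
        ‖kernel 𝕜 (effAction 𝕜 (C + Dn + Df) V) (n + 1) X - kernel 𝕜 (effAction 𝕜 C V) (n + 1) X‖ ≤
      ((((n + 1 + 1) * (n + 1 + 2) : ℕ) : ℝ) / 2 * sn *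
          ∑ m' ∈ range (Fintype.card Γ / 2 + 1),
            (if n + 1 + 2 ≤ 2 * m' then ((2 * m').choose (n + 1 + 2) : ℝ) * κn ^ (2 * m' - (n + 1 + 2)) * Nn m' else 0) +
        (∑ n' ∈ Ico 2 N₀, (ρn⁻¹ ^ (n + 1) * κn⁻¹ ^ (2 * (n' - 1)) * (αn ^ (n' - 1) * Real.exp n')) *
            ∑ δ ∈ (Fintype.piFinset fun _ : Fin n' => range (Fintype.card Γ / 2 + 1)) with n + 1 + 2 * (n' - 1) ≤ ∑ a, 2 * δ a,
              ∏ a, (Real.exp 2 * (κn + ρn)) ^ (2 * δ a) * Nn (δ a) +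
          ρn⁻¹ ^ (n + 1) * (Real.exp 1 * normV Γ κn ρn Nn) *
            (Real.exp 1 * αn * normV Γ κn ρn Nn / κn ^ 2) ^ (N₀ - 1) / (1 - Real.exp 1 * αn * normV Γ κn ρn Nn / κn ^ 2))) +
        ((((n + 1 + 1) * (n + 1 + 2) : ℕ) : ℝ) / 2 * (sD / R) * mL (n + 3) +
          ‖(2 : 𝕜)⁻¹‖ * ∑ a ∈ range (n + 2), ∑ b ∈ range (n + 2),
            (if a + b = n + 1 then (((a + 1) * (b + 1) : ℕ) : ℝ) *
              (αf * (mV (a + 1) / R) * nV (b + 1) + αf * nV (a + 1) * (mV (b + 1) / R)) else 0)) := by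
  classical
  set W : GrassmannAlgebra 𝕜 Γ := effAction 𝕜 C V with hW
  have hWe : W ∈ evenPart 𝕜 Γ := effAction_mem_evenPart C hVe hV0
  have hW0 : constPart 𝕜 W = 0 := constPart_effAction 𝕜 C V hZC
  -- the far partition functions along the path are units; in particular at `s = 1`
  have hZs : ∀ s ∈ Set.Icc (0 : ℝ) 1, effPartitionFn 𝕜 (s • Df) W ≠ 0 := fun s hs =>
    effPartitionFn_smul_isUnit_of_gram Df q hq f g hκf hf hg hG W hWe hW0 Nf hNf0 hNf hαf hfrow hfcol hρf hθf hs
  have hZf : IsUnit (effPartitionFn 𝕜 Df W) := by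
    have h := hZs 1 ⟨zero_le_one, le_rfl⟩
    rw [one_smul] at h
    exact isUnit_iff_ne_zero.2 h
  -- FAR bracket
  have hfarB := sum_norm_kernel_effAction_sub_self_le_of_far Df W hW0 (mem_evenPart_iff.1 hWe) hZs hfar hsD0 hsD hαf.le hαf.le
    hfrow hfcol d hd0 hRpos hdR w nV mV mL hnV hmV hVs0 hVsm n p hVsL
  -- NEAR bracket on `W₁ := effAction Df W`: graded orders `≥ 2` + entry-cost first order
  set W₁ : GrassmannAlgebra 𝕜 Γ := effAction 𝕜 Df W with hW₁
  have hW₁e : W₁ ∈ evenPart 𝕜 Γ := effAction_mem_evenPart Df hWe hW0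
  have hW₁0 : constPart 𝕜 W₁ = 0 := constPart_effAction 𝕜 Df W hZf
  have hge2 := sum_norm_kernel_effAction_sub_gaussConv_le_graded_of_gramBounded Dn hκn hGBn W₁ hW₁e hW₁0 Nn hNn0 hNn hαn hnrow hncol hρn hθn hN₀
    (Nat.succ_pos n) p w
  have hNn1 : ∀ (m' : ℕ) (t : Fin (2 * m')) (a : Γ), ∑ Y ∈ univ.filter (fun Y : Fin (2 * m') → Γ => Y t = a),
      ‖kernel 𝕜 W₁ (2 * m') Y‖ * (fun _ : Finset Γ => (1 : ℝ)) (univ.image Y) ≤ Nn m' := by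
    intro m' t a
    simp only [mul_one]
    exact hNn m' t a
  have hfo' := sum_wt_norm_kernel_gaussConv_sub_le_entry_of_gramBounded IsTreeWeight.const_one Dn hκn.le hGBn hsn W₁ hW₁e Nn hNn0 hNn1 (n + 1) p w
  simp only [one_mul] at hfo'
  have hnearB : ∑ X ∈ univ.filter (fun X : Fin (n + 1) → Γ => X p = w),
      ‖kernel 𝕜 (effAction 𝕜 Dn W₁) (n + 1) X - kernel 𝕜 W₁ (n + 1) X‖ ≤
      (((n + 1 + 1) * (n + 1 + 2) : ℕ) : ℝ) / 2 * sn *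
          ∑ m' ∈ range (Fintype.card Γ / 2 + 1),
            (if n + 1 + 2 ≤ 2 * m' then ((2 * m').choose (n + 1 + 2) : ℝ) * κn ^ (2 * m' - (n + 1 + 2)) * Nn m' else 0) +
        (∑ n' ∈ Ico 2 N₀, (ρn⁻¹ ^ (n + 1) * κn⁻¹ ^ (2 * (n' - 1)) * (αn ^ (n' - 1) * Real.exp n')) *
            ∑ δ ∈ (Fintype.piFinset fun _ : Fin n' => range (Fintype.card Γ / 2 + 1)) with n + 1 + 2 * (n' - 1) ≤ ∑ a, 2 * δ a,
              ∏ a, (Real.exp 2 * (κn + ρn)) ^ (2 * δ a) * Nn (δ a) +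
          ρn⁻¹ ^ (n + 1) * (Real.exp 1 * normV Γ κn ρn Nn) *
            (Real.exp 1 * αn * normV Γ κn ρn Nn / κn ^ 2) ^ (N₀ - 1) / (1 - Real.exp 1 * αn * normV Γ κn ρn Nn / κn ^ 2)) := by
    calc ∑ X ∈ univ.filter (fun X : Fin (n + 1) → Γ => X p = w), ‖kernel 𝕜 (effAction 𝕜 Dn W₁) (n + 1) X - kernel 𝕜 W₁ (n + 1) X‖
        ≤ ∑ X ∈ univ.filter (fun X : Fin (n + 1) → Γ => X p = w),
            (‖kernel 𝕜 (gaussConv 𝕜 Dn W₁) (n + 1) X - kernel 𝕜 W₁ (n + 1) X‖ +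
              ‖kernel 𝕜 (effAction 𝕜 Dn W₁ - gaussConv 𝕜 Dn W₁) (n + 1) X‖) := by
          refine sum_le_sum fun X _ => ?_
          have h : kernel 𝕜 (effAction 𝕜 Dn W₁) (n + 1) X - kernel 𝕜 W₁ (n + 1) X =
              (kernel 𝕜 (gaussConv 𝕜 Dn W₁) (n + 1) X - kernel 𝕜 W₁ (n + 1) X) +
                kernel 𝕜 (effAction 𝕜 Dn W₁ - gaussConv 𝕜 Dn W₁) (n + 1) X := by
            rw [sub_eq_add_neg (effAction 𝕜 Dn W₁), kernel_add, ← neg_one_smul 𝕜 (gaussConv 𝕜 Dn W₁), kernel_smul]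
            ring
          rw [h]
          exact norm_add_le _ _
      _ ≤ _ := by rw [sum_add_distrib]; exact add_le_add hfo' hge2
  exact sum_norm_kernel_effAction_defect_le_of_split 𝕜 C Dn Df V hZC hZf _ hnearB hfarB

end Summit.HubbardSuperconductivity.HubbardSuperconductivity.Theorems.TwoVolumeDefect

end
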